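import Literature.NumberTheory.Automorphic.ArchDiagonalTorus              -- ★ D1′b: `circleDiagonal`, `circleDiagonal_mem_unitaryGroupOfForm_diagonal`, `archLocal`, `GLnMixedPiEquiv`
import Literature.NumberTheory.Automorphic.UnitaryGroupFormTransport      -- ★ `formCongr`, `conj_mem_unitaryGroupOfForm`
import Literature.NumberTheory.Rogawski1990.EndoscopicEmbedding          -- ★ `endoGL`, `coe_endoGL_eq`, `map_endoGL`
import HarnessLib

/-!
# The Cayley frame of `U(Φ₂)(ℂ) = U(1,1)`: the circle torus `P·diag(a,b)·P⁻¹` of Rogawski's antidiagonal `H_∞ = U(Φ₂) × U(Φ₁)` at a complex place,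
# its image `ι(P·diag(a,b)·P⁻¹, u) ∼ diag(a, u, b)` under the endoscopic pattern, and «conjugacy in `GL_N(L ⊗ ℝ)` is place-wise»

Topic `NumberTheory/Automorphic`; namespace `Literature.NumberTheory.Automorphic.UnitaryGroup` (as ★ `ArchDiagonalTorus`, ★ `ArchTorusWeylAction`).
THEOREMS ONLY (no `def`, no named fact, no instance, no notation, no `sorry`; net debt 0).  Cell `pub/hodgecm-mathlib`, F0∕P3a, topic T6 ∕ road D2′
gap «(V9)-curve-lift» (LEAD F0P3a-plan (g8) WORD T7-35 ∕ T7-45; author B-p12 (g27)): FILE A (local algebra) of the lift of Rogawski's singular curve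
`γ(θ, φ, ψ)` to the carriers of ★ `archExplicitDelta`; FILE B = ★ `Rogawski1990/ArchSingularCurveNormPair`.  HC_CM is proved only modulo the printed
citations until rung 0 closes; nothing printed is asserted here.

THE MATHEMATICS.  The `H`-side carrier of the archimedean transfer factor is `U(Φ₂)(L⁺ ⊗ ℝ) × U(Φ₁)(L⁺ ⊗ ℝ)` with the ANTIDIAGONAL `Φ₂ = (0 1; 1 0)`
(★ `UnitaryGroup.arch`), whose compact Cartan at a complex place is not diagonal: with the Cayley frame `P = (1 1; 1 −1)` one has `P̄ᵀ Φ₂ P = diag(2, −2)`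
(`formCongr_cayleyTwo`), so `P · diag(a, b) · P⁻¹ ∈ U(Φ₂)(ℂ)` for `a, b ∈ S¹` (`cayley_conj_circleDiagonal_mem_archLocal`; in coordinates
`½ (a+b  a−b; a−b  a+b)`, i.e. `z · (cos ψ  i sin ψ; i sin ψ  cos ψ)` for `a, b = z e^{±iψ}` — `coe_cayley_conj_circleDiagonal`), scalar `a · 1₂` at a
coincidence `a = b` (`…_of_eq`).  The endoscopic pattern `ι` (★ `endoGL`: the 2-block on `{e₁, e₃}`, the 1-block on `e₂`) sends `(diag(a,b), (u))` to
`diag(a, u, b)` (`endoGL_circleDiagonal`), hence `ι(P·diag(a,b)·P⁻¹, u) = ι(P,1) · diag(a,u,b) · ι(P,1)⁻¹` is conjugate to the torus point `diag(a, u, b)`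
by a conjugator INDEPENDENT of `(a, b, u)` (`isConj_endoGL_cayley_conj_circleDiagonal`).  Finally (§2), for a CM field `L` (no real place,
`L ⊗ ℝ ≅ ℂ^W` via ★ `GLnMixedPiEquiv`) two elements of `GL_N(L ⊗ ℝ)` are conjugate as soon as they are conjugate at every complex place
(`isConj_of_forall_isConj_map_evalC`) — the form in which ★ `IsArchNormPair` (= `IsConj` of `ι_∞(γ_H)` and `γ` in `GL₃(L ⊗ ℝ)`) is checked.

## References
* [Rogawski1990] J. D. Rogawski, *Automorphic Representations of Unitary Groups in Three Variables*, Ann. of Math. Stud. 123 (1990): §4.8 Case (a) p. 53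
  (the pattern `(* 0 *; 0 * 0; * 0 *)`), §4.9 pp. 54–55 (`H = U(2) × U(1)`, `ι(γ_H) ↔ γ`), §8.2 pp. 122–123 (the compact Cartan, `γ(θ, φ, ψ)`), §3.1 p. 19,
  §14.3 p. 234.
* [BrockerTomDieck1985] Th. Bröcker, T. tom Dieck, *Representations of Compact Lie Groups*, GTM 98 (1985), IV (3.1) (the diagonal torus of `U(n)`).
* [PlatonovRapinchuk1994] V. Platonov, A. Rapinchuk, *Algebraic Groups and Number Theory* (1994), §2.3 (unitary groups of hermitian forms, change of frame).
-/

set_option autoImplicit false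

noncomputable section

open NumberField NumberField.InfinitePlace Matrix
open scoped MatrixGroups ComplexConjugate

/-! ## §1 One complex place: the Cayley frame of `U(Φ₂)(ℂ) = U(1,1)`, the torus of `U(Φ₁)(ℂ)`, and `ι(P·diag(a,b)·P⁻¹, u) ∼ diag(a, u, b)` -/

namespace Literature.NumberTheory.Automorphic.UnitaryGroup

open Literature.NumberTheory.Rogawski1990

section Local

/-- `det (1 1; 1 −1) = −2 ≠ 0`: the Cayley frame `P = (1 1; 1 −1)` is invertible. [cite: Rogawski1990, §8.2 p. 122] -/
theorem det_cayleyTwo_ne_zero : Matrix.det !![(1 : ℂ), 1; 1, -1] ≠ 0 := by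
  rw [Matrix.det_fin_two_of]; norm_num

/-- The inverse of the Cayley frame: `P⁻¹ = ½ P`. [cite: Rogawski1990, §8.2 p. 122] -/
theorem coe_inv_cayleyTwo :
    (((Matrix.GeneralLinearGroup.mkOfDetNeZero !![(1 : ℂ), 1; 1, -1] det_cayleyTwo_ne_zero)⁻¹ : GL (Fin 2) ℂ) :
        Matrix (Fin 2) (Fin 2) ℂ) = !![(1 / 2 : ℂ), 1 / 2; 1 / 2, -(1 / 2)] := by
  rw [Matrix.GeneralLinearGroup.coe_inv, Matrix.GeneralLinearGroup.val_mkOfDetNeZero]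
  refine Matrix.inv_eq_left_inv ?_
  ext i j; fin_cases i <;> fin_cases j <;> norm_num [Matrix.mul_apply, Fin.sum_univ_two]

/-- **The Cayley frame transports `Φ₂ = (0 1; 1 0)` to the diagonal form `diag(2, −2)`**: `P̄ᵀ (σ_w Φ₂) P = diag(2, −2)` — so `P · U(diag) · P⁻¹ ⊆ U(Φ₂)(ℂ)`
(the compact Cartan of `U(1,1)` in the antidiagonal frame). [cite: Rogawski1990, §8.2 p. 122; §4.9 p. 54] -/
theorem formCongr_cayleyTwo {L : Type*} [Field L] (f : L →+* ℂ) :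
    formCongr (starRingEnd ℂ) (Matrix.GeneralLinearGroup.mkOfDetNeZero !![(1 : ℂ), 1; 1, -1] det_cayleyTwo_ne_zero)
        ((Matrix.of fun i j : Fin 2 => if i.val + j.val + 1 = 2 then (1 : L) else 0).map f) =
      Matrix.diagonal ![(2 : ℂ), -2] := by
  ext i j
  fin_cases i <;> fin_cases j <;>
    simp [formCongr, Matrix.mul_apply, Fin.sum_univ_two, Matrix.GeneralLinearGroup.val_mkOfDetNeZero] <;> norm_num

variable (L : Type) [Field L] (w : {w : InfinitePlace L // IsComplex w})

/-- **`P · diag(z₁, z₂) · P⁻¹ ∈ U(Φ₂)(ℂ)` at every complex place** (`z_i ∈ S¹`): the torus of `U(1,1)` in Rogawski's antidiagonal frame `Φ₂`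
(★ `conj_mem_unitaryGroupOfForm` along `formCongr_cayleyTwo`, ★ `circleDiagonal_mem_unitaryGroupOfForm_diagonal`). [cite: Rogawski1990, §8.2 p. 122; §4.9 p. 54] -/
theorem cayley_conj_circleDiagonal_mem_archLocal (z : Fin 2 → Circle) :
    Matrix.GeneralLinearGroup.mkOfDetNeZero !![(1 : ℂ), 1; 1, -1] det_cayleyTwo_ne_zero * circleDiagonal 2 z *
        (Matrix.GeneralLinearGroup.mkOfDetNeZero !![(1 : ℂ), 1; 1, -1] det_cayleyTwo_ne_zero)⁻¹ ∈
      archLocal L 2 (Matrix.of fun i j : Fin 2 => if i.val + j.val + 1 = 2 then (1 : L) else 0) w := by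
  refine conj_mem_unitaryGroupOfForm (starRingEnd ℂ) _ _ ?_
  rw [formCongr_cayleyTwo]
  exact circleDiagonal_mem_unitaryGroupOfForm_diagonal 2 z _

/-- `σ_w Φ₁ = diag(1)`. [cite: Rogawski1990, §4.9 p. 54] -/
theorem antidiagOne_map (f : L →+* ℂ) :
    (Matrix.of fun i j : Fin 1 => if i.val + j.val + 1 = 1 then (1 : L) else 0).map f = Matrix.diagonal fun _ => (1 : ℂ) := by
  ext i j; fin_cases i; fin_cases j; simp

/-- **`diag(u) ∈ U(Φ₁)(ℂ)`** (`u ∈ S¹`). [cite: Rogawski1990, §4.9 p. 54] -/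
theorem circleDiagonal_mem_archLocal_antidiagOne (z : Fin 1 → Circle) :
    circleDiagonal 1 z ∈ archLocal L 1 (Matrix.of fun i j : Fin 1 => if i.val + j.val + 1 = 1 then (1 : L) else 0) w := by
  change circleDiagonal 1 z ∈ unitaryGroupOfForm (starRingEnd ℂ) _
  rw [antidiagOne_map]
  exact circleDiagonal_mem_unitaryGroupOfForm_diagonal 1 z _

/-- **`ι(diag(a, b), (u)) = diag(a, u, b)`**: the endoscopic pattern places the `U(Φ₂)`-block on `{e₁, e₃}` and the `U(Φ₁)`-entry on `e₂` (★ `coe_endoGL_eq`).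
[cite: Rogawski1990, §4.8 Case (a) p. 53; §8.2 p. 122] -/
theorem endoGL_circleDiagonal (a b u : Circle) :
    endoGL (circleDiagonal 2 ![a, b], circleDiagonal 1 ![u]) = circleDiagonal 3 ![a, u, b] := by
  refine Matrix.GeneralLinearGroup.ext fun i j => ?_
  rw [coe_endoGL_eq, coe_circleDiagonal, coe_circleDiagonal, coe_circleDiagonal]
  fin_cases i <;> fin_cases j <;> simp

/-- **`ι(P·diag(a,b)·P⁻¹, (u))` is conjugate to `diag(a, u, b)` in `GL₃(ℂ)`** by the CONSTANT conjugator `ι(P, 1)` — matching of the lifted `H`-curve with the torus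
curve, uniformly in the parameter. [cite: Rogawski1990, §8.2 p. 122; §4.9 p. 54] -/
theorem isConj_endoGL_cayley_conj_circleDiagonal (a b u : Circle) :
    IsConj (endoGL (Matrix.GeneralLinearGroup.mkOfDetNeZero !![(1 : ℂ), 1; 1, -1] det_cayleyTwo_ne_zero * circleDiagonal 2 ![a, b] *
        (Matrix.GeneralLinearGroup.mkOfDetNeZero !![(1 : ℂ), 1; 1, -1] det_cayleyTwo_ne_zero)⁻¹, circleDiagonal 1 ![u]))
      (circleDiagonal 3 ![a, u, b]) := by
  rw [← endoGL_circleDiagonal]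
  have hprod : (Matrix.GeneralLinearGroup.mkOfDetNeZero !![(1 : ℂ), 1; 1, -1] det_cayleyTwo_ne_zero * circleDiagonal 2 ![a, b] *
        (Matrix.GeneralLinearGroup.mkOfDetNeZero !![(1 : ℂ), 1; 1, -1] det_cayleyTwo_ne_zero)⁻¹, circleDiagonal 1 ![u]) =
      (Matrix.GeneralLinearGroup.mkOfDetNeZero !![(1 : ℂ), 1; 1, -1] det_cayleyTwo_ne_zero, (1 : GL (Fin 1) ℂ)) *
        (circleDiagonal 2 ![a, b], circleDiagonal 1 ![u]) *
        (Matrix.GeneralLinearGroup.mkOfDetNeZero !![(1 : ℂ), 1; 1, -1] det_cayleyTwo_ne_zero, (1 : GL (Fin 1) ℂ))⁻¹ := by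
    simp only [Prod.mk_mul_mk, Prod.inv_mk, one_mul, inv_one, mul_one]
  rw [hprod, map_mul, map_mul, map_inv]
  exact isConj_iff.2 ⟨(endoGL (Matrix.GeneralLinearGroup.mkOfDetNeZero !![(1 : ℂ), 1; 1, -1] det_cayleyTwo_ne_zero, (1 : GL (Fin 1) ℂ)))⁻¹,
    by group⟩

/-- **The lifted `H`-curve in coordinates**: `P · diag(a, b) · P⁻¹ = ½ (a+b  a−b; a−b  a+b)` (for `a = z e^{iψ}`, `b = z e^{−iψ}` this is print's
`z · (cos ψ  i sin ψ; i sin ψ  cos ψ)`, eigenvalues `a, b`). [cite: Rogawski1990, §8.2 pp. 122–123] -/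
theorem coe_cayley_conj_circleDiagonal (z : Fin 2 → Circle) :
    ((Matrix.GeneralLinearGroup.mkOfDetNeZero !![(1 : ℂ), 1; 1, -1] det_cayleyTwo_ne_zero * circleDiagonal 2 z *
        (Matrix.GeneralLinearGroup.mkOfDetNeZero !![(1 : ℂ), 1; 1, -1] det_cayleyTwo_ne_zero)⁻¹ : GL (Fin 2) ℂ) : Matrix (Fin 2) (Fin 2) ℂ) =
      !![((z 0 : ℂ) + z 1) / 2, ((z 0 : ℂ) - z 1) / 2; ((z 0 : ℂ) - z 1) / 2, ((z 0 : ℂ) + z 1) / 2] := by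
  rw [Units.val_mul, Units.val_mul, coe_inv_cayleyTwo, Matrix.GeneralLinearGroup.val_mkOfDetNeZero, coe_circleDiagonal]
  ext i j
  fin_cases i <;> fin_cases j <;> simp [Matrix.mul_apply, Fin.sum_univ_two, Matrix.vecMul_diagonal] <;> ring

/-- At a coincidence `a = b` the lifted `H`-block is the SCALAR `a · 1₂` (the split-singular point `γ₀`: `g(0) = e^{iθ} · 1₂`). [cite: Rogawski1990, §8.2 p. 122] -/
theorem coe_cayley_conj_circleDiagonal_of_eq (a : Circle) :
    ((Matrix.GeneralLinearGroup.mkOfDetNeZero !![(1 : ℂ), 1; 1, -1] det_cayleyTwo_ne_zero * circleDiagonal 2 ![a, a] *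
        (Matrix.GeneralLinearGroup.mkOfDetNeZero !![(1 : ℂ), 1; 1, -1] det_cayleyTwo_ne_zero)⁻¹ : GL (Fin 2) ℂ) : Matrix (Fin 2) (Fin 2) ℂ) =
      (a : ℂ) • (1 : Matrix (Fin 2) (Fin 2) ℂ) := by
  rw [coe_cayley_conj_circleDiagonal]
  ext i j; fin_cases i <;> fin_cases j <;> simp

end Local

/-! ## §2 Conjugacy in `GL_N(L ⊗ ℝ)` is checked place by place (CM field: no real place) -/

section PlaceWise

variable (L : Type) [Field L] [NumberField L] [IsCMField L] {N : ℕ}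

/-- **Conjugacy in `GL_N(L ⊗ ℝ) = Π_w GL_N(ℂ)` from conjugacy at every complex place** (`L` CM, so `L ⊗ ℝ ≅ ℂ^W`, ★ `GLnMixedPiEquiv`): choose a conjugator
at each `w` and assemble. [cite: Rogawski1990, §3.1 p. 19; §14.3 p. 234] -/
theorem isConj_of_forall_isConj_map_evalC {x y : GL (Fin N) (mixedEmbedding.mixedSpace L)}
    (h : ∀ w : {w : InfinitePlace L // IsComplex w},
      IsConj (Matrix.GeneralLinearGroup.map (evalC L w) x) (Matrix.GeneralLinearGroup.map (evalC L w) y)) :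
    IsConj x y := by
  choose u hu using fun w => isConj_iff.1 (h w)
  refine isConj_iff.2 ⟨(GLnMixedPiEquiv (↥(maximalRealSubfield L)) L (IsCMField.complexConj L) N (IsCMField.complexConj_ne_one L)
    (complexConj_smul_infinitePlace L)).symm u, ?_⟩
  apply (GLnMixedPiEquiv (↥(maximalRealSubfield L)) L (IsCMField.complexConj L) N (IsCMField.complexConj_ne_one L)
    (complexConj_smul_infinitePlace L)).injective
  rw [map_mul, map_mul, map_inv, ContinuousMulEquiv.apply_symm_apply]
  funext w
  rw [Pi.mul_apply, Pi.mul_apply, Pi.inv_apply, GLnMixedPiEquiv_apply, GLnMixedPiEquiv_apply]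
  exact hu w

end PlaceWise

end Literature.NumberTheory.Automorphic.UnitaryGroup

end
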